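import Summits.CriticalPhenomena.SAWScalingLimit.Theorems.SAWRestrictionRigidityLimitExistsCocycleOfAvoidanceLimit
import Summits.CriticalPhenomena.SAWScalingLimit.Theorems.SAWChargeContinuationSAWAvoidanceLawOfScalingLimit
import Summits.CriticalPhenomena.SAWScalingLimit.Theorems.SAWRestrictionRigidityLimitExistsNecessity
import Summits.CriticalPhenomena.SAWScalingLimit.Theorems.SAWRestrictionRigidityLimitExistsTightNecessity
import HarnessLib

/-!
# Crux `LimitExists` (stmt-CriticalPhenomena-1371), line `registered` — the avoidance stub (C) is summit-implied

Necessity of the registered stub (C) = `AvoidanceCocycleLimit` (stmt-CriticalPhenomena-1369, the route's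
r3 crux and its CHEAPEST FALSIFIER target) from the sub-problem statement: composing the tree theorems
`SAWChargeContinuation.avoidanceLimit_of_sawScalingLimit : SAWScalingLimit → AvoidanceLimit`
(portmanteau sandwich under the SLE_{8/3} law, whose touching-without-entering event is null) and the line's
bridge `avoidanceCocycleLimit_of_avoidanceLimit : AvoidanceLimit → AvoidanceCocycleLimit` (p145541).

* `avoidanceCocycleLimit_of_sawScalingLimit : SAWScalingLimit → AvoidanceCocycleLimit` and the
  contrapositive `not_sawScalingLimit_of_not_avoidanceCocycleLimit` — a transfer-matrix kill of (C)
  (oscillating `Z_δ(D')/Z_δ(D)`) would refute the Lawler–Schramm–Werner conjecture AS TYPED, not merely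
  this line or this route.
* `inputs_of_sawScalingLimit` — all three open inputs of the line that are lattice statements about
  existence, (T) `EventualTight`, (C) `AvoidanceCocycleLimit`, and the crux `LimitExists` itself, follow
  from the sub-problem statement (with `limitExists_of_sawScalingLimit`, p145874, and
  `eventualTight_of_limitExists`, p148374).

Everything proved, standard axioms. [cite: LawlerSchrammWerner2003Restriction, Thm. 6.1 (p. 23)]
-/

noncomputable section

namespace Summit.CriticalPhenomena.SAWScalingLimit.Theorems.SAWRestrictionRigidityLimitExists

open Summit.CriticalPhenomena.SAWScalingLimit.Theses.SAWRestrictionRigidity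
  (LimitExists EventualTight AvoidanceCocycleLimit)

/-- **`SAWScalingLimit → AvoidanceCocycleLimit`**: the value-free hull-avoidance limit (the registered
stub (C) of the line, item stmt-CriticalPhenomena-1369) is a corollary of the sub-problem statement —
`avoidanceLimit_of_sawScalingLimit` (value `Φ'_A(0)^{5/8}` under the SLE_{8/3} limit) followed by the
line's bridge `avoidanceCocycleLimit_of_avoidanceLimit`. [cite: LawlerSchrammWerner2003Restriction, Thm. 6.1 (p. 23)] -/
theorem avoidanceCocycleLimit_of_sawScalingLimit : _root_.SAWScalingLimit → Summit.CriticalPhenomena.SAWScalingLimit.Theses.SAWRestrictionRigidity.AvoidanceCocycleLimit :=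
  fun hS => avoidanceCocycleLimit_of_avoidanceLimit
    (Summit.CriticalPhenomena.SAWScalingLimit.Theorems.SAWChargeContinuation.avoidanceLimit_of_sawScalingLimit
      hS)

/-- **`¬ AvoidanceCocycleLimit → ¬ SAWScalingLimit`** (for the negatives index): a kill of the route's
cheapest falsifier target refutes the conjunct as typed. [folklore] -/
theorem not_sawScalingLimit_of_not_avoidanceCocycleLimit (h : ¬ AvoidanceCocycleLimit) :
    ¬ _root_.SAWScalingLimit :=
  fun hS => h (avoidanceCocycleLimit_of_sawScalingLimit hS)

/-- **The existence inputs of the line are summit-implied**: under `SAWScalingLimit` the crux `LimitExists`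
(p145874), its tightness stub (T) `EventualTight` (via `eventualTight_of_limitExists`, p148374) and its
avoidance stub (C) `AvoidanceCocycleLimit` all hold. [folklore] -/
theorem inputs_of_sawScalingLimit (hS : _root_.SAWScalingLimit) :
    LimitExists ∧ EventualTight ∧ AvoidanceCocycleLimit :=
  ⟨limitExists_of_sawScalingLimit hS, eventualTight_of_limitExists (limitExists_of_sawScalingLimit hS),
    avoidanceCocycleLimit_of_sawScalingLimit hS⟩

end Summit.CriticalPhenomena.SAWScalingLimit.Theorems.SAWRestrictionRigidityLimitExists

end
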